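import Literature.NumberTheory.EllipticCurves.BSDSelmerCMPConverse
import Literature.NumberTheory.EllipticCurves.ComplexMultiplicationBurungaleFlachDescentProofs
import Literature.NumberTheory.EllipticCurves.ComplexMultiplicationTwistIsogenyCertProofs
import Literature.NumberTheory.EllipticCurves.ComplexMultiplicationMaximalOrderLeavesProofs
import Literature.NumberTheory.EllipticCurves.ComplexMultiplicationLFunctionIsogenyHoldsProofs
import Literature.NumberTheory.EllipticCurves.SelmerCorankIsogenyProofs
import Literature.NumberTheory.EllipticCurves.BSDSelmerParityDokchitserBaseChangeProofs
import Literature.NumberTheory.EllipticCurves.AnalyticRankOverNumberFieldProofs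
import Literature.NumberTheory.EllipticCurves.IwasawaLeadingTermProofs
import Literature.NumberTheory.EllipticCurves.ComplexMultiplicationHasCMIffProofs
import Literature.NumberTheory.EllipticCurves.ComplexMultiplicationShaHeckeProofs
import HarnessLib

/-!
# Burungale–Tian's rank-zero `p`-converse for CM curves: the printed descent `K → ℚ`, proved

Sibling *proofs* file (theorems only: no definition, no named fact, no instance) of
`Literature.NumberTheory.EllipticCurves.BSDSelmerCMPConverse`, for its named fact
`Literature.NumberTheory.EllipticCurves.burungaleTian_analyticRank_eq_zero_of_selmerCorank_eq_zero_of_hasCM`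
(A. A. Burungale, Y. Tian, *A rank zero `p`-converse to a theorem of Gross–Zagier, Kolyvagin and
Rubin*, Ann. of Math. (2) 203 (2026), 1–13 = arXiv:2506.03465, **Theorem 1.1**, the clause
"In particular, if `E` descends to `ℚ`, then (1.1) holds" with `r = 0`: for a CM elliptic curve
`E/ℚ` and any prime `p`, `corank_{ℤ_p} Sel_{p^∞}(E/ℚ) = 0 ⟹ ord_{s=1} L(s, E/ℚ) = 0`).

## The printed proof (arXiv v2, pp. 2–6) and what is formalised here

Theorem 1.1 proper is a statement over the CM field: *"Let `E` be an elliptic curve defined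
over an imaginary quadratic field `K`, with complex multiplication by an order of `K`. Let `p` be
a prime. Then `corank_{ℤ_p} Sel_{p^∞}(E/K) = 0 ⟹ ord_{s=1} L(s, E/K) = 0`."* Its proof (§3.1,
p. 6) rests on **Theorem 3.1** (for a CM newform `f` of even weight `k` and any prime:
`H¹_f(ℚ, V_{F_λ}(f)(k/2)) = 0 ⟹ ord_{s=k/2} L(s, f) = 0`), itself deduced from the CM case of
**Kato's main conjecture** in `Λ ⊗ ℚ` (Theorem 2.6: the equivariant main conjecture for
imaginary quadratic fields up to `⊗ ℚ`, Johnson-Leung–Kings 2011 (Theorem 2.1), transported to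
Beilinson–Kato elements by Kato, Astérisque 295, §15), Kato's exact sequence (14.9.3), Tate's
Euler–Poincaré formula and Kato's explicit reciprocity law (Thm. 12.5 (1)); then Deuring's
`L(s, E/K) = L(s, ψ) L(s, ψ̄) = L(s, f) L(s, f̄)` and
`Sel_{p^∞}(E/K)^∨ ⊗ K ≃ H¹_f(ℚ, V(f)) ⊕ H¹_f(ℚ, V(f̄))`. None of this has a vocabulary in the
tree or in Mathlib (no Iwasawa cohomology `H¹(ℤ[1/p], T ⊗ Λ)`, no Beilinson–Kato elements, no
Galois representation `V_{F_λ}(f)` of a newform, no Bloch–Kato Selmer group of `V_p E`, no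
explicit reciprocity law, no Hecke character `ψ_{E/K}`); the statement over `K` is therefore the
terminal leaf of this file, entering as the HYPOTHESIS `hBT` of the assembly, transcribed in the
tree's vocabulary for the curves the corollary needs — base changes `E_K` of elliptic curves
`E/ℚ` with CM by the maximal order `𝓞_K` (`j(E) ∈ maximalCMJInvariants`) to their CM field `K`
(`IsCMFieldOfJ K j(E)`), which have CM by the order `𝓞_K` of `K` defined over `K` (Silverman,
*Advanced Topics*, II.2.2(b)) and descend to `ℚ` — with `corank_{ℤ_p} Sel_{p^∞}(E/K)` the tree's
`(W.baseChange K).selmerCorank p` and `ord_{s=1} L(s, E/K)` the tree's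
`(W.baseChange K).analyticRank` (`= W.analyticRankOver K`, `AnalyticRankOverNumberField`).

What IS proved here is the last paragraph of the printed proof (p. 6): *"If `E` descends to `ℚ`,
then `corank_{ℤ_p} Sel_{p^∞}(E/K) = 2 · corank_{ℤ_p} Sel_{p^∞}(E/ℚ)` and
`ord_{s=1} L(s, E/K) = 2 · ord_{s=1} L(s, E/ℚ)`, which concludes the proof of Theorem 1.1"*,
together with the reduction of an arbitrary CM curve over `ℚ` to one with CM by `𝓞_K`:

* `selmerCorank_baseChange_cmField` (**proved, unconditional**): the first doubling identity,
  from the quadratic descent of `p^∞`-Selmer coranks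
  (`selmerCorank_baseChange_quadratic_holds`: `corank Sel(E/K) = corank Sel(E/ℚ) +
  corank Sel(E^{(d_K)}/ℚ)`, T. Dokchitser 2013 §4 / Dokchitser–Dokchitser 2010 Lemma 4.14), the
  CM isogeny `E ∼ E^{(d_K)}` over `ℚ` (`isIsogenous_quadraticTwist_cmFieldDiscr_holds`, Milne
  1972 Thm. 3 through Burungale–Flach 2024, with `isIsogenous_quadraticTwist_discr_of_isCMFieldOfJ`)
  and the isogeny invariance of the corank (`IsIsogenous.selmerCorank_eq`, Greenberg 1999 §1);
* `analyticRank_baseChange_cmField` (**proved from modularity** `hasEntireLFunction_rat`): the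
  second doubling identity, from Artin formalism `L(E/K, s) = L(E, s) L(E^{(d_K)}, s)`
  (`analyticRankOver_eq_add_of_hasEntireLFunction_rat`, Ireland–Rosen Prop. 20.5.4(b), proved in
  the tree given the entire continuations) and `L(E^{(d_K)}, s) = L(E, s)` (Knapp 11.67,
  `analyticRank_eq_of_isIsogenous'`, proved);
* `finite_selmerGroupPInfty_iff_selmerCorank_eq_zero` (**proved**): `Sel_{p^∞}(E/F)` is finite
  iff its `ℤ_p`-corank is `0` (it is `p`-primary with finite `p`-torsion; Greenberg 1999 §1) — the
  dictionary `H¹_f(ℚ, V_p E) = 0 ⟺ corank 0` between Theorem 3.1 and (1.1);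
* `burungaleTian_analyticRank_eq_zero_of_selmerCorank_eq_zero_of_hasCM_of_cmField`
  (**the assembly**): `hBT` + modularity ⟹ the named fact, for every `E/ℚ` with geometric CM —
  an arbitrary CM curve being `ℚ`-isogenous to one with CM by `𝓞_K`
  (`exists_isIsogenous_j_mem_maximalCMJInvariants_of_hasCM_holds`, Silverman *Advanced Topics*
  Ex. 2.12(b), proved in the tree), with corank and analytic rank isogeny invariants;
* `cmField_form_of_burungaleTian` (**bookkeeping**): conversely the named fact and modularity
  give back `hBT`, so for curves descending to `ℚ` the statement over `K` and the statement
  over `ℚ` are equivalent — the file vendors nothing stronger than the fact it serves, and the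
  deep content of Theorem 1.1 is untouched by the descent;
* `burungaleTian_analyticRank_eq_zero_of_selmerCorank_eq_zero_of_hasCM_of_L_one_ne_zero` and
  `L_one_ne_zero_of_burungaleTian` (**Remark 3.2 in the tree's vocabulary**): the fact is
  equivalent (the forward direction unconditionally, the converse given modularity) to the
  `L`-value form "`E/ℚ` CM, `Sel_{p^∞}(E/ℚ)` finite ⟹ `L(E, 1) ≠ 0`", which is Theorem 3.1 for
  `f = f_E` (`k = 2`, `F = ℚ`, `V(f)(1) = V_p E`, `H¹_f(ℚ, V_p E) = 0 ⟺ Sel_{p^∞}(E/ℚ)` finite,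
  `L(s, f_E) = L(E, s)`).

* `…_of_deuringHecke` forms (appended): the same four statements with modularity replaced by the
  Deuring–Hecke continuation of `L(E/ℚ, s)` for CM curves
  (`hasEntireLFunction_of_j_mem_maximalCMJInvariants`, Silverman *Advanced Topics* Cor. II.10.5.1
  — the continuation Burungale–Tian use, `L(s, E/K) = L(s, ψ) L(s, ψ̄)`), transported to all CM
  curves over `ℚ` along the isogeny to the maximal order (`hasEntireLFunction_of_hasCM_of_deuringHecke`,
  via `hasEntireLFunction_iff_of_isIsogenous'`: isogenous curves have the same formal
  `L`-function, Knapp 11.67, hence the same entire continuations).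

Nothing is asserted: the only undischarged inputs are `hBT` (Theorem 1.1 over `K`) and, for the
analytic doubling, an entire continuation of `L(E/ℚ, s)` — either the modularity fact
`WeierstrassCurve.hasEntireLFunction_rat` (BCDT 2001), the shared leaf of the whole `bsd` cone, or
the CM continuation `hasEntireLFunction_of_j_mem_maximalCMJInvariants` (Deuring–Hecke). The discharge
`burungaleTian_analyticRank_eq_zero_of_selmerCorank_eq_zero_of_hasCM_holds` is NOT in reach: it is
Theorem 1.1 over `K`, i.e. Kato's main conjecture for CM forms plus the explicit reciprocity law.

## Design notes

* `K : Type` (universe `0`) throughout, as in the sibling CM files, because the tree's Artin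
  formalism and Selmer descent are vendored at universe `0` (`exists_isCMFieldOfJ` lands there).
* The hypothesis `hBT` is written out in both theorems that mention it (no abbreviation: a
  `def … : Prop` here would be a new named fact, D-0026).
* TODO(general form): Thm. 1.1 for any `E/K` with CM by an order of `K` (`HasRationalCM` over
  `K`) and Thm. 3.1 for CM newforms of higher weight need the objects listed above.

## References

* A. A. Burungale, Y. Tian, *A rank zero `p`-converse to a theorem of Gross–Zagier, Kolyvagin and
  Rubin*, Ann. of Math. (2) 203 (2026), no. 1, 1–13 = arXiv:2506.03465v2: Thm. 1.1 (p. 1),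
  Thm. 2.1, Thm. 2.6 (pp. 4–5), Thm. 3.1, Remark 3.2 and the proof of Thm. 1.1 (pp. 5–6).
  [BurungaleTian2026]
* T. Dokchitser (2013), §4; Dokchitser–Dokchitser, Ann. of Math. 172 (2010), Lemma 4.14;
  Ireland–Rosen, Prop. 20.5.4; Greenberg, LNM 1716 (1999), §1; Burungale–Flach, Camb. J. Math. 12
  (2024), proof of Cor. 2; Milne, Invent. Math. 17 (1972), Thm. 3; Silverman, *Advanced Topics*,
  Cor. II.10.5.1. [Dokchitser2013ParityNotes] [IrelandRosen1990] [Greenberg1999LNM]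
  [BurungaleFlach2024] [Milne1972ArithmeticAV] [SilvermanATAEC1994]
-/

noncomputable section

open scoped Classical AddSubgroup

open WeierstrassCurve

namespace Literature.NumberTheory.EllipticCurves

/-! ### `Sel_{p^∞}` finite iff corank zero (the dictionary `H¹_f(ℚ, V_p E) = 0 ⟺ (1.1)`) -/

/-- **`Sel_{p^∞}(E/F)` is finite iff `corank_{ℤ_p} Sel_{p^∞}(E/F) = 0`** (elliptic curve over a
number field `F`, `p` prime). `Sel_{p^∞}(E/F) ⊆ H¹(F, E[p^∞])` is `p`-primary
(`exists_pow_nsmul_eq_zero_galH1Primary`) with finite `p`-torsion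
(`finite_torsionBy_selmerGroupPInfty`, from the finiteness of the `p`-Selmer group, Silverman
X.4.2(b)), i.e. cofinitely generated, `≅ (ℚ_p/ℤ_p)^r ⊕ (finite)`; so it is finite iff `r = 0`
(`finite_of_zpCorank_eq_zero`, `zpCorank_eq_zero_of_finite`); in Burungale–Tian's language,
`H¹_f(ℚ, V_p E) = 0 ⟺ corank_{ℤ_p} Sel_{p^∞}(E/ℚ) = 0`. [cite: Greenberg1999LNM, §1 pp. 54–57] -/
theorem finite_selmerGroupPInfty_iff_selmerCorank_eq_zero {F : Type} [Field F] [NumberField F]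
    (W : WeierstrassCurve F) [W.IsElliptic] (p : ℕ) [Fact p.Prime] :
    Finite (selmerGroupPInfty W p) ↔ W.selmerCorank p = 0 := by
  refine ⟨fun h ↦ ?_, fun h0 ↦ ?_⟩
  · haveI := h
    exact zpCorank_eq_zero_of_finite _ p
  · have hprim : ∀ x : selmerGroupPInfty W p, ∃ k : ℕ, p ^ k • x = 0 := fun x ↦ by
      obtain ⟨k, hk⟩ := exists_pow_nsmul_eq_zero_galH1Primary W p (x : galH1Primary W p)
      exact ⟨k, Subtype.ext (by rw [AddSubmonoidClass.coe_nsmul, hk, ZeroMemClass.coe_zero])⟩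
    haveI : Finite (selmerGroupPInfty W p)[(p : ℤ)] := finite_torsionBy_selmerGroupPInfty W p
    exact finite_of_zpCorank_eq_zero p hprim h0

/-! ### The two doubling identities of the printed proof (p. 6) -/

/-- **`corank_{ℤ_p} Sel_{p^∞}(E/K) = 2 · corank_{ℤ_p} Sel_{p^∞}(E/ℚ)`** for an elliptic curve
`E/ℚ` with CM by the maximal order `𝓞_K` (`j(E) ∈ maximalCMJInvariants`) and `K` its CM field
(`IsCMFieldOfJ K j(E)`), every prime `p` — the first identity of the last paragraph of the proof
of Burungale–Tian's Theorem 1.1 (arXiv p. 6), proved: `corank Sel(E/K) = corank Sel(E/ℚ) +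
corank Sel(E^{(d_K)}/ℚ)` (T. Dokchitser 2013, §4, `selmerCorank_baseChange_quadratic_holds`) and
`E^{(d_K)} ∼ E` over `ℚ` (Milne 1972, Thm. 3, `isIsogenous_quadraticTwist_cmFieldDiscr_holds`),
the corank being an isogeny invariant (Greenberg 1999, §1, `IsIsogenous.selmerCorank_eq`).
[cite: BurungaleTian2026, proof of Thm. 1.1 (arXiv p. 6)] -/
theorem selmerCorank_baseChange_cmField (W : WeierstrassCurve ℚ) [W.IsElliptic]
    (hj : W.j ∈ maximalCMJInvariants) (K : Type) [Field K] [NumberField K]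
    (hK : IsCMFieldOfJ K W.j) (p : ℕ) [Fact p.Prime] :
    (W.baseChange K).selmerCorank p = 2 * W.selmerCorank p := by
  have hD : (NumberField.discr K : ℚ) ≠ 0 := by exact_mod_cast NumberField.discr_ne_zero K
  haveI := W.isElliptic_quadraticTwist hD
  have hiso : IsIsogenous W (W.quadraticTwist (NumberField.discr K : ℚ)) :=
    isIsogenous_quadraticTwist_discr_of_isCMFieldOfJ isIsogenous_quadraticTwist_cmFieldDiscr_holds
      W hj K hK
  rw [selmerCorank_baseChange_quadratic_holds W K hK.1 p, ← hiso.selmerCorank_eq p, two_mul]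

/-- **`ord_{s=1} L(s, E/K) = 2 · ord_{s=1} L(s, E/ℚ)`** for an elliptic curve `E/ℚ` with CM by
the maximal order `𝓞_K` and `K` its CM field — the second identity of the last paragraph of the
proof of Burungale–Tian's Theorem 1.1 (arXiv p. 6), proved from the modularity of elliptic curves
over `ℚ` (`WeierstrassCurve.hasEntireLFunction_rat`, hypothesis `hmod`: Breuil–Conrad–Diamond–Taylor
2001, Thm. A, which supplies the entire continuations without which the tree's analytic ranks are
junk): `ord_{s=1} L(E/K, s) = ord_{s=1} L(E, s) + ord_{s=1} L(E^{(d_K)}, s)` (Artin formalism,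
Ireland–Rosen Prop. 20.5.4(b), `analyticRankOver_eq_add_of_hasEntireLFunction_rat`) and
`L(E^{(d_K)}, s) = L(E, s)` since `E^{(d_K)} ∼ E` over `ℚ` (Milne 1972, Thm. 3; Knapp 11.67,
`analyticRank_eq_of_isIsogenous'`). Here `ord_{s=1} L(s, E/K)` is the tree's
`(W.baseChange K).analyticRank`. [cite: BurungaleTian2026, proof of Thm. 1.1 (arXiv p. 6)] -/
theorem analyticRank_baseChange_cmField (hmod : hasEntireLFunction_rat)
    (W : WeierstrassCurve ℚ) [W.IsElliptic] (hj : W.j ∈ maximalCMJInvariants)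
    (K : Type) [Field K] [NumberField K] (hK : IsCMFieldOfJ K W.j) :
    (W.baseChange K).analyticRank = 2 * W.analyticRank := by
  have hD : (NumberField.discr K : ℚ) ≠ 0 := by exact_mod_cast NumberField.discr_ne_zero K
  haveI := W.isElliptic_quadraticTwist hD
  have hiso : IsIsogenous W (W.quadraticTwist (NumberField.discr K : ℚ)) :=
    isIsogenous_quadraticTwist_discr_of_isCMFieldOfJ isIsogenous_quadraticTwist_cmFieldDiscr_holds
      W hj K hK
  have h := W.analyticRankOver_eq_add_of_hasEntireLFunction_rat K hmod hK.1
  rw [← analyticRank_eq_of_isIsogenous' hiso, ← two_mul] at h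
  exact h

/-! ### The assembly: Theorem 1.1 over the CM field ⟹ the named fact over `ℚ` -/

/-- **Burungale–Tian's Theorem 1.1 over `K` implies the vendored rank-zero `p`-converse over `ℚ`**
(the clause "In particular, if `E` descends to `ℚ`, then (1.1) holds" of Thm. 1.1, arXiv p. 1,
proved as on p. 6). Hypothesis `hBT` is Theorem 1.1 — *"Let `E` be an elliptic curve defined over
an imaginary quadratic field `K`, with complex multiplication by an order of `K`. Let `p` be a
prime. Then `corank_{ℤ_p} Sel_{p^∞}(E/K) = 0 ⟹ ord_{s=1} L(s, E/K) = 0`"* — transcribed for the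
curves `E_K = W.baseChange K`, `W/ℚ` elliptic with `j(W) ∈ maximalCMJInvariants` (CM by `𝓞_K`)
and `K` its CM field (`IsCMFieldOfJ K j(W)`; then `E_K` has CM by the order `𝓞_K` of `K`,
defined over `K`: Silverman, *Advanced Topics*, II.2.2(b)), with `corank_{ℤ_p} Sel_{p^∞}(E/K)` the
tree's `(W.baseChange K).selmerCorank p` and `ord_{s=1} L(s, E/K)` the tree's
`(W.baseChange K).analyticRank`; hypothesis `hmod` is modularity over `ℚ`
(`WeierstrassCurve.hasEntireLFunction_rat`). Proof, as printed: an arbitrary CM curve `E/ℚ` is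
`ℚ`-isogenous to one with CM by `𝓞_K` (`exists_isIsogenous_j_mem_maximalCMJInvariants_of_hasCM_holds`),
isogenous curves having the same Selmer corank (`IsIsogenous.selmerCorank_eq`) and analytic rank
(`analyticRank_eq_of_isIsogenous'`); for the latter curve `corank Sel(E/K) = 2 corank Sel(E/ℚ) = 0`
(`selmerCorank_baseChange_cmField`), so `hBT` gives `ord_{s=1} L(s, E/K) = 0 = 2 ord_{s=1} L(E, s)`
(`analyticRank_baseChange_cmField`). [cite: BurungaleTian2026, Thm. 1.1 and its proof (arXiv pp. 1, 6)] -/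
theorem burungaleTian_analyticRank_eq_zero_of_selmerCorank_eq_zero_of_hasCM_of_cmField
    (hBT : ∀ (W : WeierstrassCurve ℚ) [W.IsElliptic], W.j ∈ maximalCMJInvariants →
      ∀ (K : Type) [Field K] [NumberField K], IsCMFieldOfJ K W.j →
        ∀ (p : ℕ) [Fact p.Prime], (W.baseChange K).selmerCorank p = 0 →
          (W.baseChange K).analyticRank = 0)
    (hmod : hasEntireLFunction_rat) :
    burungaleTian_analyticRank_eq_zero_of_selmerCorank_eq_zero_of_hasCM := by
  intro W _ hCM p _ h0
  obtain ⟨W₀, _, hiso, hj⟩ := exists_isIsogenous_j_mem_maximalCMJInvariants_of_hasCM_holds W hCM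
  obtain ⟨K, _, _, hK⟩ := exists_isCMFieldOfJ hj
  have h0' : W₀.selmerCorank p = 0 := by rw [← hiso.selmerCorank_eq p, h0]
  have hK0 : (W₀.baseChange K).selmerCorank p = 0 := by
    rw [selmerCorank_baseChange_cmField W₀ hj K hK p, h0', mul_zero]
  have han := hBT W₀ hj K hK p hK0
  rw [analyticRank_baseChange_cmField hmod W₀ hj K hK] at han
  rw [analyticRank_eq_of_isIsogenous' hiso]
  omega

/-- **Bookkeeping: the vendored fact gives back Theorem 1.1 over `K` for curves descending to
`ℚ`.** Conversely to `…_of_cmField`, the named fact over `ℚ` together with modularity (`hmod`)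
implies the hypothesis `hBT` there: if `corank Sel(E/K) = 2 corank Sel(E/ℚ)` vanishes so does
`corank Sel(E/ℚ)`, whence `ord_{s=1} L(E, s) = 0` and `ord_{s=1} L(s, E/K) = 2 · 0`. So for the
curves it is stated for, `hBT` is equivalent to the fact it serves (granted modularity): the
descent neither weakens nor strengthens Theorem 1.1's corollary.
[cite: BurungaleTian2026, Thm. 1.1 and its proof (arXiv pp. 1, 6)] -/
theorem cmField_form_of_burungaleTian
    (h : burungaleTian_analyticRank_eq_zero_of_selmerCorank_eq_zero_of_hasCM)
    (hmod : hasEntireLFunction_rat) :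
    ∀ (W : WeierstrassCurve ℚ) [W.IsElliptic], W.j ∈ maximalCMJInvariants →
      ∀ (K : Type) [Field K] [NumberField K], IsCMFieldOfJ K W.j →
        ∀ (p : ℕ) [Fact p.Prime], (W.baseChange K).selmerCorank p = 0 →
          (W.baseChange K).analyticRank = 0 := by
  intro W _ hj K _ _ hK p _ hK0
  have hCM : W.HasCM := hasCM_of_j_mem_maximalCMJInvariants_holds W hj
  have h0 : W.selmerCorank p = 0 := by
    have h2 := selmerCorank_baseChange_cmField W hj K hK p
    omega
  rw [analyticRank_baseChange_cmField hmod W hj K hK, h W hCM p h0, mul_zero]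

/-! ### Remark 3.2 in the tree's vocabulary: the `L`-value form -/

/-- **The rank-zero `p`-converse from its `L`-value form, unconditionally.** If for every CM
elliptic curve `E/ℚ` and every prime `p` the finiteness of `Sel_{p^∞}(E/ℚ)` forces `L(E, 1) ≠ 0`
(hypothesis `hL` — Burungale–Tian's Theorem 3.1 for the weight-`2` CM newform `f = f_E`:
`H¹_f(ℚ, V_p E) = 0 ⟹ ord_{s=1} L(s, f_E) = 0`, with `H¹_f(ℚ, V_p E) = 0 ⟺ Sel_{p^∞}(E/ℚ)`
finite and `L(s, f_E) = L(E, s)`; Remark 3.2: *"This deduction of the rank zero `p`-converse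
from Kato's main conjecture holds for any elliptic newform"*), then the named fact holds: corank
`0` means `Sel_{p^∞}(E/ℚ)` finite (`finite_selmerGroupPInfty_iff_selmerCorank_eq_zero`), and
`L(E, 1) ≠ 0` forces `ord_{s=1} L(E, s) = 0` with no continuation hypothesis
(`analyticRank_eq_zero_of_entireLFunction_one_ne_zero`).
[cite: BurungaleTian2026, Thm. 3.1 and Remark 3.2 (arXiv pp. 5–6)] -/
theorem burungaleTian_analyticRank_eq_zero_of_selmerCorank_eq_zero_of_hasCM_of_L_one_ne_zero
    (hL : ∀ (W : WeierstrassCurve ℚ) [W.IsElliptic], W.HasCM → ∀ (p : ℕ) [Fact p.Prime],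
      Finite (selmerGroupPInfty W p) → W.entireLFunction 1 ≠ 0) :
    burungaleTian_analyticRank_eq_zero_of_selmerCorank_eq_zero_of_hasCM := by
  intro W _ hCM p _ h0
  exact analyticRank_eq_zero_of_entireLFunction_one_ne_zero W
    (hL W hCM p ((finite_selmerGroupPInfty_iff_selmerCorank_eq_zero W p).2 h0))

/-- **Conversely, the named fact gives the `L`-value form, granted modularity.** From
`burungaleTian_analyticRank_eq_zero_of_selmerCorank_eq_zero_of_hasCM` (hypothesis `h`) and the
modularity of elliptic curves over `ℚ` (`hmod`, needed to read `L(E, 1) ≠ 0` off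
`ord_{s=1} L(E, s) = 0`: `analyticRank_eq_zero_iff_L_one_ne_zero_of_hasEntireLFunction_rat`):
for `E/ℚ` CM and `p` prime, `Sel_{p^∞}(E/ℚ)` finite ⟹ `L(E, 1) ≠ 0` — Theorem 3.1 for `f = f_E`.
[cite: BurungaleTian2026, Thm. 3.1 and Remark 3.2 (arXiv pp. 5–6)] -/
theorem L_one_ne_zero_of_burungaleTian
    (h : burungaleTian_analyticRank_eq_zero_of_selmerCorank_eq_zero_of_hasCM)
    (hmod : hasEntireLFunction_rat) (W : WeierstrassCurve ℚ) [W.IsElliptic] (hCM : W.HasCM)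
    (p : ℕ) [Fact p.Prime] (hfin : Finite (selmerGroupPInfty W p)) :
    W.entireLFunction 1 ≠ 0 :=
  (analyticRank_eq_zero_iff_L_one_ne_zero_of_hasEntireLFunction_rat hmod W).1
    (h W hCM p ((finite_selmerGroupPInfty_iff_selmerCorank_eq_zero W p).1 hfin))

/-! ### The same below the Deuring–Hecke continuation instead of modularity

Burungale–Tian continue `L(s, E/K)` by Deuring's `L(s, E/K) = L(s, ψ) L(s, ψ̄)` and Hecke; the
tree's leaf for CM curves over `ℚ` is `hasEntireLFunction_of_j_mem_maximalCMJInvariants`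
(Silverman, *Advanced Topics*, Cor. II.10.5.1), a special case of `hasEntireLFunction_rat`. -/

/-- **Entire continuation of `L(E, s)` is a `ℚ`-isogeny invariant.** `ℚ`-isogenous elliptic
curves have the same formal `L`-function (Knapp, *Elliptic Curves*, Thm. 11.67, the tree theorem
`LFunction_eq_of_isIsogenous_holds`), hence the same `L`-series and the same set of entire
continuations `entireContinuations`. [cite: Knapp1993, Thm. 11.67 (PDF p. 281)] -/
theorem hasEntireLFunction_iff_of_isIsogenous' {W W' : WeierstrassCurve ℚ} [W.IsElliptic]
    [W'.IsElliptic] (hiso : IsIsogenous W W') : W.HasEntireLFunction ↔ W'.HasEntireLFunction := by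
  have h : W.LSeries = W'.LSeries :=
    LSeries_eq_of_LFunction_eq (LFunction_eq_of_isIsogenous_holds W W' hiso)
  simp only [WeierstrassCurve.HasEntireLFunction, WeierstrassCurve.entireContinuations, h]

/-- **`L(E/ℚ, s)` is entire for every CM elliptic curve over `ℚ`, from Deuring–Hecke** (hypothesis
`hH`: `hasEntireLFunction_of_j_mem_maximalCMJInvariants`, the continuation for CM by the maximal
order, Silverman *Advanced Topics* Cor. II.10.5.1 with Thm. II.10.5(b)): an arbitrary CM curve is
`ℚ`-isogenous to one with CM by `𝓞_K` (`exists_isIsogenous_j_mem_maximalCMJInvariants_of_hasCM_holds`,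
*Advanced Topics* Ex. 2.12(b)) and the continuation is an isogeny invariant
(`hasEntireLFunction_iff_of_isIsogenous'`).
[cite: SilvermanATAEC1994, Ch. II Cor. 10.5.1 (PDF p. 171) and Exercise 2.12(b)] -/
theorem hasEntireLFunction_of_hasCM_of_deuringHecke
    (hH : hasEntireLFunction_of_j_mem_maximalCMJInvariants) (W : WeierstrassCurve ℚ) [W.IsElliptic]
    (hCM : W.HasCM) : W.HasEntireLFunction := by
  obtain ⟨W₀, _, hiso, hj⟩ := exists_isIsogenous_j_mem_maximalCMJInvariants_of_hasCM_holds W hCM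
  exact (hasEntireLFunction_iff_of_isIsogenous' hiso).2 (hH W₀ hj)

/-- **`ord_{s=1} L(s, E/K) = 2 · ord_{s=1} L(s, E/ℚ)`, pointwise form**: as
`analyticRank_baseChange_cmField`, for `E/ℚ` with CM by `𝓞_K` and `K` its CM field, assuming only
that `L(E, s)` itself has an entire continuation (`hW`); the twist `E^{(d_K)} ∼ E` then has one too
(`hasEntireLFunction_iff_of_isIsogenous'`), which is all Artin formalism needs
(`analyticRankOver_eq_add_of_finrank_eq_two`). Burungale–Tian, proof of Thm. 1.1 (arXiv p. 6).
[cite: BurungaleTian2026, proof of Thm. 1.1 (arXiv p. 6)] -/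
theorem analyticRank_baseChange_cmField_of_hasEntireLFunction (W : WeierstrassCurve ℚ)
    [W.IsElliptic] (hj : W.j ∈ maximalCMJInvariants) (K : Type) [Field K] [NumberField K]
    (hK : IsCMFieldOfJ K W.j) (hW : W.HasEntireLFunction) :
    (W.baseChange K).analyticRank = 2 * W.analyticRank := by
  have hD : (NumberField.discr K : ℚ) ≠ 0 := by exact_mod_cast NumberField.discr_ne_zero K
  haveI := W.isElliptic_quadraticTwist hD
  have hiso : IsIsogenous W (W.quadraticTwist (NumberField.discr K : ℚ)) :=
    isIsogenous_quadraticTwist_discr_of_isCMFieldOfJ isIsogenous_quadraticTwist_cmFieldDiscr_holds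
      W hj K hK
  have hWd : (W.quadraticTwist (NumberField.discr K : ℚ)).HasEntireLFunction :=
    (hasEntireLFunction_iff_of_isIsogenous' hiso).1 hW
  have h := W.analyticRankOver_eq_add_of_finrank_eq_two K hK.1 hW hWd
  rw [← analyticRank_eq_of_isIsogenous' hiso, ← two_mul] at h
  exact h

/-- **`ord_{s=1} L(s, E/K) = 2 · ord_{s=1} L(s, E/ℚ)` from Deuring–Hecke** (`hH`) instead of
modularity. [cite: BurungaleTian2026, proof of Thm. 1.1 (arXiv p. 6)] -/
theorem analyticRank_baseChange_cmField_of_deuringHecke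
    (hH : hasEntireLFunction_of_j_mem_maximalCMJInvariants) (W : WeierstrassCurve ℚ) [W.IsElliptic]
    (hj : W.j ∈ maximalCMJInvariants) (K : Type) [Field K] [NumberField K]
    (hK : IsCMFieldOfJ K W.j) : (W.baseChange K).analyticRank = 2 * W.analyticRank :=
  analyticRank_baseChange_cmField_of_hasEntireLFunction W hj K hK (hH W hj)

/-- **The assembly below Deuring–Hecke**: Burungale–Tian's Theorem 1.1 over `K` (hypothesis
`hBT`, as in `burungaleTian_analyticRank_eq_zero_of_selmerCorank_eq_zero_of_hasCM_of_cmField`)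
and the CM continuation `hasEntireLFunction_of_j_mem_maximalCMJInvariants` (`hH`) imply the
vendored rank-zero `p`-converse over `ℚ` — same proof, trust base `{hBT, Deuring–Hecke}` instead
of `{hBT, modularity}`. [cite: BurungaleTian2026, Thm. 1.1 and its proof (arXiv pp. 1, 6)] -/
theorem burungaleTian_analyticRank_eq_zero_of_selmerCorank_eq_zero_of_hasCM_of_cmField_of_deuringHecke
    (hBT : ∀ (W : WeierstrassCurve ℚ) [W.IsElliptic], W.j ∈ maximalCMJInvariants →
      ∀ (K : Type) [Field K] [NumberField K], IsCMFieldOfJ K W.j →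
        ∀ (p : ℕ) [Fact p.Prime], (W.baseChange K).selmerCorank p = 0 →
          (W.baseChange K).analyticRank = 0)
    (hH : hasEntireLFunction_of_j_mem_maximalCMJInvariants) :
    burungaleTian_analyticRank_eq_zero_of_selmerCorank_eq_zero_of_hasCM := by
  intro W _ hCM p _ h0
  obtain ⟨W₀, _, hiso, hj⟩ := exists_isIsogenous_j_mem_maximalCMJInvariants_of_hasCM_holds W hCM
  obtain ⟨K, _, _, hK⟩ := exists_isCMFieldOfJ hj
  have h0' : W₀.selmerCorank p = 0 := by rw [← hiso.selmerCorank_eq p, h0]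
  have hK0 : (W₀.baseChange K).selmerCorank p = 0 := by
    rw [selmerCorank_baseChange_cmField W₀ hj K hK p, h0', mul_zero]
  have han := hBT W₀ hj K hK p hK0
  rw [analyticRank_baseChange_cmField_of_deuringHecke hH W₀ hj K hK] at han
  rw [analyticRank_eq_of_isIsogenous' hiso]
  omega

/-- **Bookkeeping below Deuring–Hecke**: the vendored fact and the CM continuation (`hH`) give
back Theorem 1.1 over `K` for curves descending to `ℚ` (as `cmField_form_of_burungaleTian`).
[cite: BurungaleTian2026, Thm. 1.1 and its proof (arXiv pp. 1, 6)] -/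
theorem cmField_form_of_burungaleTian_of_deuringHecke
    (h : burungaleTian_analyticRank_eq_zero_of_selmerCorank_eq_zero_of_hasCM)
    (hH : hasEntireLFunction_of_j_mem_maximalCMJInvariants) :
    ∀ (W : WeierstrassCurve ℚ) [W.IsElliptic], W.j ∈ maximalCMJInvariants →
      ∀ (K : Type) [Field K] [NumberField K], IsCMFieldOfJ K W.j →
        ∀ (p : ℕ) [Fact p.Prime], (W.baseChange K).selmerCorank p = 0 →
          (W.baseChange K).analyticRank = 0 := by
  intro W _ hj K _ _ hK p _ hK0
  have hCM : W.HasCM := hasCM_of_j_mem_maximalCMJInvariants_holds W hj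
  have h0 : W.selmerCorank p = 0 := by
    have h2 := selmerCorank_baseChange_cmField W hj K hK p
    omega
  rw [analyticRank_baseChange_cmField_of_deuringHecke hH W hj K hK, h W hCM p h0, mul_zero]

/-- **The `L`-value form below Deuring–Hecke**: from the vendored fact (`h`) and the CM
continuation (`hH`, which makes `ord_{s=1} L(E, s) = 0 ⟺ L(E, 1) ≠ 0` available for every CM
curve over `ℚ`: `hasEntireLFunction_of_hasCM_of_deuringHecke` with
`WeierstrassCurve.analyticRank_eq_zero_iff_holds`), for `E/ℚ` CM and `p` prime,
`Sel_{p^∞}(E/ℚ)` finite ⟹ `L(E, 1) ≠ 0` — Theorem 3.1 for `f = f_E`.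
[cite: BurungaleTian2026, Thm. 3.1 and Remark 3.2 (arXiv pp. 5–6)] -/
theorem L_one_ne_zero_of_burungaleTian_of_deuringHecke
    (h : burungaleTian_analyticRank_eq_zero_of_selmerCorank_eq_zero_of_hasCM)
    (hH : hasEntireLFunction_of_j_mem_maximalCMJInvariants) (W : WeierstrassCurve ℚ) [W.IsElliptic]
    (hCM : W.HasCM) (p : ℕ) [Fact p.Prime] (hfin : Finite (selmerGroupPInfty W p)) :
    W.entireLFunction 1 ≠ 0 :=
  (analyticRank_eq_zero_iff_holds (W := W) (hasEntireLFunction_of_hasCM_of_deuringHecke hH W hCM)).1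
    (h W hCM p ((finite_selmerGroupPInfty_iff_selmerCorank_eq_zero W p).1 hfin))

end Literature.NumberTheory.EllipticCurves

end
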